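import Summits.QuantumFields.YangMills.Theorems.BalabanUVNodesN20HellingerEndpointRoad
import Summits.QuantumFields.YangMills.Theorems.BalabanUVNodesN20OverAgeRefreshProcessAtClassWeights

/-!
# BalabanUVNodes ∕ node N20 (NE7b) — THE HELLINGER ROAD'S STRICT UNIT BUDGET IS NO LETTER, AND THE V-SIDE CAPSTONE: positive class weights CONTINUOUS in the
# source on the compact window make every summable per-set TV budget strictly sub-unit at EVERY key; hence `exists_hybridNE7_of_endpointLetters` WITHOUT its head
# condition `η_K < ½`, and — by name through p622199 — stub 2's three hybrid faces `HybridNE7` from two REFRESH PROCESSES + TAME TILTS + (R′) + (R‑c)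

Cell `pub-ymgap` (HUMAN RULING D-0062 Track A ∕ director-ym R399 (3a) second-wave width seats), WIDTH SEAT `pub-ymgap-dag-n20-w5` (node n20 = NE7b),
generation g4, CLAIM-2 ∕ INTENT-3 (bus 2026-08-28T09:42:19Z).  Key item K3⁷ `SpineGivenEndpointR13SepCoPH` (stmt-QuantumFields-20544; skeleton of record v5
941dddb108cbaacf, stub 2 `stub_expansion13H` — faces `KeyedRelWeight` (N20), `KeyedShellWeight` (N21), `KeyedCoreEdgeHolderD4` (N19′)); filed
`--kind proof --supports … --as helper`.  COUNT-NEUTRAL.  THEOREMS ONLY (0 `def`, 0 `instance`, 0 `notation`, 0 `sorry`).  ADDITIVE — imports this seat's p619159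
`…N20HellingerEndpointRoad` (`target_of_endpointResponse`, `classLawTV_of_affinityDefect`, `eta_nonneg_of_affinityDefect`; through it dag-n20-w4's p609004
`exists_hybridNE7_of_target_of_classLawTV`) and this seat's p622199 `…N20OverAgeRefreshProcessAtClassWeights` (`affinityDefectLetter_of_refreshProcesses_and_tameTilts`);
every cited theorem BY NAME; modifies nothing.

WHY (located by ■ dag-n19-w4 g6, bus 09:23Z: «the capstone ⇒ `HybridNE7` is n20-w5's ∕ n14-w2's lineage»; and by p619159's own READING (iii)).  The tree's hybrid binder list
`T4MatchingAssembly.HybridNE7` demands `lt_one : ∀ K, W K + Wsh K < 1` — AT EVERY KEY, not eventually; p609004 therefore asks `hρ1 : ∀ K, ρ K < 1` and p619159's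
`exists_hybridNE7_of_endpointLetters` asks `hη2 : ∀ K, η K < ½`.  But every landed SUPPLIER of the affinity-defect letter (H) — dag-n19-w4's p618979
`affinityDefectLetter_of_tameTilts` and everything plugged into it (this seat's p622199, dag-n20-w4's `SlotDom` editions) — returns `η_K = wm_K + 𝔅∕r_K² (+ 1 on K < K₀)`,
which is `≥ 1` on the finite head: the head condition CANNOT be met as typed.  THIS FILE removes it:
* §1 [folklore] ★ `abs_classLawGap_lt_one` — for POSITIVE weights on a finite class set every per-set class-law gap is STRICTLY below one (`S = ∅` gives `0`; otherwise
  `q(S) > 0` and `p(S) ≤ 1`); ★★ `exists_classLawTV_budget_lt_one` — positivity + CONTINUITY of the class weights in the source on the compact window `|t| ≤ l₀` (`0 ≤ l₀`)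
  turn ANY summable per-set TV budget `ρ ≥ 0` into `ρ' ≤ ρ` with `0 ≤ ρ' K < 1` at EVERY `K`, `Summable ρ'`, and the same TV letter (extreme value theorem
  `IsCompact.exists_isMaxOn` for each `S ⊆ T K`, then a finite `sup'`).  So `hρ1` ∕ `hη2` are NO letters once the weights are continuous in `t` — and on the road they are
  DIFFERENTIABLE there (`hdA` ∕ `hdB`).
* §2 ★★★ `exists_hybridNE7_of_endpointLetters_noHead` — p619159 `exists_hybridNE7_of_endpointLetters` WITHOUT `hη2`: (H) with `Σ√η < ∞`, (R′) with `Σ R₁ < ∞`, (R‑c), positive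
  weights differentiable in the source on the window, the E1∕E2 dictionary ⇒ `∃ Wsh shA shB, (∀ K, 0 ≤ Wsh K ∧ Wsh K ≤ √(2η_K) ∧ Wsh K < 1) ∧
  HybridNE7 l₀ vol T A B (fun _ _ => ∅) (fun _ => 0) shA shB Wsh (K ↦ l₀·(R₁ K + 2√(2η_K)·√χ)∕vol)` (p609004 BY NAME on the shrunk budget).
* §3 ★★ `exists_hybridNE7_of_affinityDefectLetter_and_response` — the same from ANY (H) supplier in p618979's ∃-shape `∃ η ≥ 0, Σ√η < ∞, 1 − 𝒜_K(t) ≤ η_K` (serves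
  p618979 ∕ p620730 ∕ p622199 ∕ dag-n20-w4's editions alike, BY NAME); ★★★ CAPSTONE `exists_hybridNE7_of_refreshProcesses_tameTilts_and_response` — this seat's p622199
  ((V‑a) = two abstract REFRESH PROCESSES with their MODELLING letters, + p618979's tame tilts ∕ radii ((V‑b)) ∕ `𝔅` ∕ regime) + (R′) + (R‑c) ⇒ `∃ η Wsh shA shB, … ∧ HybridNE7 …`:
  stub 2's three hybrid faces at a key with NO head condition, NO bad class, ZERO weight budget — from ONE-RUN structural letters plus the two-run letters (V‑b) and (R′).
* §4 toy (A6): identical runs have gap `0 < 1` on every set.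
READING (located, nothing proposed).  (i) As a proof of v5's `stub_expansion13H` the capstone still needs the KEY-READING dial (plan's v6) to type `(∅, 0, shA, shB)` into
`(jc, sh, cr)` — dag-n20-w3's `exists_optShellSplit` ∕ `relWeightBound_crOfRecord₁₃VAt_cutZero` are the typing lemmas; untouched.  (ii) Continuity in `t` is the only
input §1 adds; on Bałaban's side the class weights are finite sums of exponentials of actions polynomial in the source — continuity is not a letter anyone disputes,
but it IS a hypothesis here.  (iii) `Wsh` is no longer the explicit `√(2η)` but SOME budget `≤ √(2η)`, `< 1`; consumers reading the budget only through `HybridNE7` lose nothing.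

HONEST FRAMING.  [folklore] extreme value theorem + finite-sum real analysis + by-name transfer through p619159, p609004, p622199, p618979; (H)'s suppliers' letters
(refresh processes and `hmodel` — idea-3 g13's READING of [LF‑II] (1.79)–(1.85); tame tilts ∕ (KR); radii `Σ 1∕r_K < ∞` = (V‑b) = (YG)), (R′) and (R‑c) are HYPOTHESES
produced by nobody — the two-run ones UNPRINTED for d = 4; NO estimate of Bałaban's programme is proved; nothing of Bałaban's asserted or instantiated (no `Provisos₁₃CoPH`
tuple — K0⁷ OPEN); NE7 ∕ NE7b ∕ NE7c NOT PRINTED as two-run statements for d = 4 and NOT proved; N19 ∕ N20 ∕ N21 NOT discharged; K3⁷ OPEN, v5 STANDS, not claimed; no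
summit statement is proved by this seat; counts UNMOVED (typed 28∕28 · discharged 5∕27, A 5∕28).  One finite four-torus programme at fixed ε — NOT ℝ⁴, NOT infinite
volume, NOT OS, NOT a mass gap, NOT the Clay problem (R4 closes the conditional finite-𝕋⁴ rung `BalabanLadder.UV` only).  0 `def`; 0 `sorry`; standard axioms; no cite tags.
-/

noncomputable section

namespace Summit.QuantumFields.YangMills.BalabanUVNodes.N20HellingerRoadCapstone

open Finset
open Summit.QuantumFields.BalabanUV.T4Continuum.Spine.NE7 (Target)
open Literature.MathematicalPhysics.QuantumFieldTheory.Balaban1983to89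
open T4MatchingAssembly (HybridNE7)
open Summit.QuantumFields.YangMills.BalabanUVNodes.N20HybridClassLawCharacterisation (exists_hybridNE7_of_target_of_classLawTV)
open Summit.QuantumFields.YangMills.BalabanUVNodes.N20HellingerEndpointRoad
  (classLawTV_of_affinityDefect eta_nonneg_of_affinityDefect target_of_endpointResponse)
open Summit.QuantumFields.YangMills.BalabanUVNodes.N20OverAgeRefreshProcessAtClassWeights
  (affinityDefectLetter_of_refreshProcesses_and_tameTilts)

variable {ι : Type*}

/-! ## §1 The strict unit budget is no letter: positivity gives `< 1` pointwise, continuity on the compact window gives it uniformly [folklore] -/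

section StrictBudget

/-- **★ EVERY CLASS-LAW GAP IS STRICTLY BELOW ONE** [folklore].  Positive weights `A, B` on a finite class set `T`, any `S ⊆ T`:
`|Σ_S A ∕ Σ_T A − Σ_S B ∕ Σ_T B| < 1` — for `S = ∅` the gap is `0`; otherwise `T` is nonempty, both totals are positive, `Σ_S A∕Σ_T A ≤ 1` and `Σ_S B∕Σ_T B > 0`
(and symmetrically). -/
theorem abs_classLawGap_lt_one {T S : Finset ι} {A B : ι → ℝ} (hA : ∀ τ ∈ T, 0 < A τ) (hB : ∀ τ ∈ T, 0 < B τ) (hS : S ⊆ T) :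
    |(∑ τ ∈ S, A τ) / (∑ τ ∈ T, A τ) - (∑ τ ∈ S, B τ) / (∑ τ ∈ T, B τ)| < 1 := by
  rcases S.eq_empty_or_nonempty with rfl | hne
  · simp
  · obtain ⟨σ, hσ⟩ := hne
    have hTne : T.Nonempty := ⟨σ, hS hσ⟩
    have hZA : 0 < ∑ τ ∈ T, A τ := sum_pos hA hTne
    have hZB : 0 < ∑ τ ∈ T, B τ := sum_pos hB hTne
    have hSA : 0 < ∑ τ ∈ S, A τ := sum_pos (fun τ hτ => hA τ (hS hτ)) ⟨σ, hσ⟩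
    have hSB : 0 < ∑ τ ∈ S, B τ := sum_pos (fun τ hτ => hB τ (hS hτ)) ⟨σ, hσ⟩
    have hSA1 : ∑ τ ∈ S, A τ ≤ ∑ τ ∈ T, A τ := sum_le_sum_of_subset_of_nonneg hS fun τ hτ _ => (hA τ hτ).le
    have hSB1 : ∑ τ ∈ S, B τ ≤ ∑ τ ∈ T, B τ := sum_le_sum_of_subset_of_nonneg hS fun τ hτ _ => (hB τ hτ).le
    have ha1 : (∑ τ ∈ S, A τ) / (∑ τ ∈ T, A τ) ≤ 1 := div_le_one_of_le₀ hSA1 hZA.le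
    have hb1 : (∑ τ ∈ S, B τ) / (∑ τ ∈ T, B τ) ≤ 1 := div_le_one_of_le₀ hSB1 hZB.le
    have ha0 : 0 < (∑ τ ∈ S, A τ) / (∑ τ ∈ T, A τ) := div_pos hSA hZA
    have hb0 : 0 < (∑ τ ∈ S, B τ) / (∑ τ ∈ T, B τ) := div_pos hSB hZB
    rw [abs_lt]
    constructor <;> linarith

variable {l₀ : ℝ} {T : ℕ → Finset ι} {A B : ℕ → ℝ → ι → ℝ}

/-- **★★ A SUMMABLE PER-SET TV BUDGET CAN ALWAYS BE TAKEN STRICTLY SUB-UNIT AT EVERY KEY** [folklore: extreme value theorem].  Class weights POSITIVE and CONTINUOUS in the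
source on the compact window `|t| ≤ l₀` (`0 ≤ l₀`); a per-set TV letter `∀ K t, |t| ≤ l₀ → ∀ S ⊆ T K, |p_{K,t}(S) − q_{K,t}(S)| ≤ ρ_K` with `ρ ≥ 0` summable ⇒ a budget
`ρ'` with `0 ≤ ρ' K ≤ ρ K`, `ρ' K < 1` for EVERY `K`, `Summable ρ'`, and the same letter.  (For each `S ⊆ T K` the continuous gap attains its maximum on `Icc (−l₀) l₀`, which is
`< 1` by `abs_classLawGap_lt_one`; the finite `sup'` over `S` is `< 1`; `ρ' K := min (ρ K) (max M_K 0)`.)  This is p609004's `hρ1` ∕ p619159's `hη2` DISCHARGED. -/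
theorem exists_classLawTV_budget_lt_one [DecidableEq ι] (hl₀ : 0 ≤ l₀)
    (hA : ∀ (K : ℕ) (t : ℝ), |t| ≤ l₀ → ∀ τ ∈ T K, 0 < A K t τ) (hB : ∀ (K : ℕ) (t : ℝ), |t| ≤ l₀ → ∀ τ ∈ T K, 0 < B K t τ)
    (hcA : ∀ (K : ℕ), ∀ τ ∈ T K, ContinuousOn (fun t => A K t τ) (Set.Icc (-l₀) l₀))
    (hcB : ∀ (K : ℕ), ∀ τ ∈ T K, ContinuousOn (fun t => B K t τ) (Set.Icc (-l₀) l₀))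
    {ρ : ℕ → ℝ} (hρ0 : ∀ K, 0 ≤ ρ K) (hρs : Summable ρ)
    (hρ : ∀ (K : ℕ) (t : ℝ), |t| ≤ l₀ → ∀ S ⊆ T K,
      |(∑ τ ∈ S, A K t τ) / (∑ τ ∈ T K, A K t τ) - (∑ τ ∈ S, B K t τ) / (∑ τ ∈ T K, B K t τ)| ≤ ρ K) :
    ∃ ρ' : ℕ → ℝ, (∀ K, 0 ≤ ρ' K) ∧ (∀ K, ρ' K ≤ ρ K) ∧ (∀ K, ρ' K < 1) ∧ Summable ρ' ∧
      ∀ (K : ℕ) (t : ℝ), |t| ≤ l₀ → ∀ S ⊆ T K,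
        |(∑ τ ∈ S, A K t τ) / (∑ τ ∈ T K, A K t τ) - (∑ τ ∈ S, B K t τ) / (∑ τ ∈ T K, B K t τ)| ≤ ρ' K := by
  have hIcc : ∀ {t : ℝ}, t ∈ Set.Icc (-l₀) l₀ ↔ |t| ≤ l₀ := fun {t} => by rw [Set.mem_Icc, abs_le]
  have hcpt : IsCompact (Set.Icc (-l₀) l₀) := isCompact_Icc
  have hne : (Set.Icc (-l₀) l₀).Nonempty := ⟨0, by rw [Set.mem_Icc]; constructor <;> linarith⟩
  -- per key: a uniform strict bound over the window and over all `S ⊆ T K`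
  have key : ∀ K : ℕ, ∃ M : ℝ, M < 1 ∧ ∀ t : ℝ, |t| ≤ l₀ → ∀ S ⊆ T K,
      |(∑ τ ∈ S, A K t τ) / (∑ τ ∈ T K, A K t τ) - (∑ τ ∈ S, B K t τ) / (∑ τ ∈ T K, B K t τ)| ≤ M := by
    intro K
    -- each `S` separately, by the extreme value theorem
    have perS : ∀ S ∈ (T K).powerset, ∃ m : ℝ, m < 1 ∧ ∀ t : ℝ, |t| ≤ l₀ →
        |(∑ τ ∈ S, A K t τ) / (∑ τ ∈ T K, A K t τ) - (∑ τ ∈ S, B K t τ) / (∑ τ ∈ T K, B K t τ)| ≤ m := by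
      intro S hS
      rw [mem_powerset] at hS
      set g : ℝ → ℝ := fun t =>
        |(∑ τ ∈ S, A K t τ) / (∑ τ ∈ T K, A K t τ) - (∑ τ ∈ S, B K t τ) / (∑ τ ∈ T K, B K t τ)| with hg
      have hsumA : ∀ U ⊆ T K, ContinuousOn (fun t => ∑ τ ∈ U, A K t τ) (Set.Icc (-l₀) l₀) := fun U hU =>
        continuousOn_finsetSum U fun τ hτ => hcA K τ (hU hτ)
      have hsumB : ∀ U ⊆ T K, ContinuousOn (fun t => ∑ τ ∈ U, B K t τ) (Set.Icc (-l₀) l₀) := fun U hU =>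
        continuousOn_finsetSum U fun τ hτ => hcB K τ (hU hτ)
      have hgc : ContinuousOn g (Set.Icc (-l₀) l₀) := by
        by_cases hT : (T K).Nonempty
        · refine ((ContinuousOn.div (hsumA S hS) (hsumA (T K) subset_rfl) fun t ht => ?_).sub
            (ContinuousOn.div (hsumB S hS) (hsumB (T K) subset_rfl) fun t ht => ?_)).abs
          · exact (sum_pos (hA K t (hIcc.1 ht)) hT).ne'
          · exact (sum_pos (hB K t (hIcc.1 ht)) hT).ne'
        · rw [not_nonempty_iff_eq_empty] at hT
          have hS0 : S = ∅ := subset_empty.1 (hT ▸ hS)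
          have : g = fun _ => 0 := by funext t; simp [hg, hS0]
          rw [this]; exact continuousOn_const
      obtain ⟨t₀, ht₀, hmax⟩ := hcpt.exists_isMaxOn hne hgc
      refine ⟨g t₀, abs_classLawGap_lt_one (hA K t₀ (hIcc.1 ht₀)) (hB K t₀ (hIcc.1 ht₀)) hS, fun t ht => ?_⟩
      exact hmax (hIcc.2 ht)
    choose! m hm1 hm2 using perS
    have hne' : (T K).powerset.Nonempty := ⟨∅, empty_mem_powerset _⟩
    refine ⟨(T K).powerset.sup' hne' m, (Finset.sup'_lt_iff hne').2 fun S hS => hm1 S hS, fun t ht S hS => ?_⟩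
    have hSp : S ∈ (T K).powerset := mem_powerset.2 hS
    exact (hm2 S hSp t ht).trans (Finset.le_sup' m hSp)
  choose M hM1 hM2 using key
  refine ⟨fun K => min (ρ K) (max (M K) 0), fun K => le_min (hρ0 K) (le_max_right _ _), fun K => min_le_left _ _,
    fun K => (min_le_right _ _).trans_lt (max_lt (hM1 K) one_pos), ?_, fun K t ht S hS => ?_⟩
  · exact Summable.of_nonneg_of_le (fun K => le_min (hρ0 K) (le_max_right _ _)) (fun K => min_le_left _ _) hρs
  · exact le_min (hρ K t ht S hS) ((hM2 K t ht S hS).trans (le_max_left _ _))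

end StrictBudget

/-! ## §2 The endpoint road without its head condition [folklore + by-name transfer through p619159 and p609004] -/

section Road
variable {l₀ vol : ℝ} {T : ℕ → Finset ι} {A B : ℕ → ℝ → ι → ℝ}

/-- **★★★ THE HELLINGER ROAD FROM ENDPOINT LETTERS, NO HEAD CONDITION** [folklore].  p619159 `exists_hybridNE7_of_endpointLetters` with `hη2 : ∀ K, η K < ½` REMOVED: carriers
`T K`, positive class weights DIFFERENTIABLE in the source on `|s| ≤ l₀` (`0 ≤ l₀`, `0 < vol`) with derivative carriers `A', B'`, the E1∕E2 dictionary for `Z`; (H) the affinity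
defect of the two ONE-RUN class laws bounded by `η_K` with `Σ_K √η_K < ∞`; (R′) `|E_{q_{K,s}}[B'∕B − A'∕A]| ≤ R₁ K`, `Σ R₁ < ∞`; (R‑c) the mixture second moment of the run-A
source current about any centring bounded by `χ` ⇒ `∃ Wsh shA shB`, `0 ≤ Wsh K ≤ √(2η_K)`, `Wsh K < 1` at every `K`, and
`HybridNE7 l₀ vol T A B (fun _ _ => ∅) (fun _ => 0) shA shB Wsh (K ↦ l₀·(R₁ K + 2√(2η_K)√χ)∕vol)` — p619159 `target_of_endpointResponse` + `classLawTV_of_affinityDefect`, §1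
`exists_classLawTV_budget_lt_one` (continuity from `hdA`∕`hdB`), then dag-n20-w4's `exists_hybridNE7_of_target_of_classLawTV` (p609004) BY NAME. -/
theorem exists_hybridNE7_of_endpointLetters_noHead [DecidableEq ι] (hl₀ : 0 ≤ l₀) (hvol : 0 < vol)
    (hA : ∀ (K : ℕ) (t : ℝ), |t| ≤ l₀ → ∀ τ ∈ T K, 0 < A K t τ) (hB : ∀ (K : ℕ) (t : ℝ), |t| ≤ l₀ → ∀ τ ∈ T K, 0 < B K t τ)
    (hZA : ∀ (K : ℕ) (t : ℝ), |t| ≤ l₀ → 0 < ∑ τ ∈ T K, A K t τ) (hZB : ∀ (K : ℕ) (t : ℝ), |t| ≤ l₀ → 0 < ∑ τ ∈ T K, B K t τ)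
    {Z : ℕ → ℝ → ℝ} (hZA' : ∀ (K : ℕ) (t : ℝ), |t| ≤ l₀ → Z K t = ∑ τ ∈ T K, A K t τ)
    (hZB' : ∀ (K : ℕ) (t : ℝ), |t| ≤ l₀ → Z (K + 1) t = ∑ τ ∈ T K, B K t τ)
    {A' B' : ℕ → ℝ → ι → ℝ}
    (hdA : ∀ (K : ℕ) (s : ℝ), |s| ≤ l₀ → ∀ τ ∈ T K, HasDerivAt (fun u => A K u τ) (A' K s τ) s)
    (hdB : ∀ (K : ℕ) (s : ℝ), |s| ≤ l₀ → ∀ τ ∈ T K, HasDerivAt (fun u => B K u τ) (B' K s τ) s)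
    {η R₁ : ℕ → ℝ} {χ : ℝ} {m : ℕ → ℝ → ℝ}
    (hH : ∀ (K : ℕ) (t : ℝ), |t| ≤ l₀ →
      1 - ∑ τ ∈ T K, Real.sqrt ((A K t τ / ∑ σ ∈ T K, A K t σ) * (B K t τ / ∑ σ ∈ T K, B K t σ)) ≤ η K)
    (hηs : Summable fun K => Real.sqrt (η K))
    (hR : ∀ (K : ℕ) (s : ℝ), |s| ≤ l₀ →
      |∑ τ ∈ T K, B K s τ / (∑ σ ∈ T K, B K s σ) * (B' K s τ / B K s τ - A' K s τ / A K s τ)| ≤ R₁ K)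
    (hRs : Summable R₁)
    (hχ : ∀ (K : ℕ) (s : ℝ), |s| ≤ l₀ →
      ∑ τ ∈ T K, (A K s τ / (∑ σ ∈ T K, A K s σ) + B K s τ / (∑ σ ∈ T K, B K s σ)) / 2 * (A' K s τ / A K s τ - m K s) ^ 2 ≤ χ) :
    ∃ (Wsh : ℕ → ℝ) (shA shB : ℕ → ℝ → ι → ℝ),
      (∀ K, 0 ≤ Wsh K ∧ Wsh K ≤ Real.sqrt (2 * η K) ∧ Wsh K < 1) ∧
      HybridNE7 l₀ vol T A B (fun _ _ => ∅) (fun _ => 0) shA shB Wsh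
        (fun K => l₀ * (R₁ K + 2 * Real.sqrt (2 * η K) * Real.sqrt χ) / vol) := by
  have hTgt := target_of_endpointResponse hl₀ hvol hA hB hZA hZB hZA' hZB' hdA hdB hH hR hχ hηs hRs
  have hs2 : Summable fun K => Real.sqrt (2 * η K) := by
    have : (fun K => Real.sqrt (2 * η K)) = fun K => Real.sqrt 2 * Real.sqrt (η K) := by
      funext K; exact Real.sqrt_mul (by norm_num) _
    rw [this]; exact hηs.mul_left _
  have hTV := classLawTV_of_affinityDefect hA hB hZA hZB hH
  -- continuity on the window from differentiability there
  have hIcc : ∀ {t : ℝ}, t ∈ Set.Icc (-l₀) l₀ → |t| ≤ l₀ := fun {t} ht => by rw [Set.mem_Icc] at ht; exact abs_le.2 ht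
  have hcA : ∀ (K : ℕ), ∀ τ ∈ T K, ContinuousOn (fun t => A K t τ) (Set.Icc (-l₀) l₀) :=
    fun K τ hτ t ht => (hdA K t (hIcc ht) τ hτ).continuousAt.continuousWithinAt
  have hcB : ∀ (K : ℕ), ∀ τ ∈ T K, ContinuousOn (fun t => B K t τ) (Set.Icc (-l₀) l₀) :=
    fun K τ hτ t ht => (hdB K t (hIcc ht) τ hτ).continuousAt.continuousWithinAt
  obtain ⟨ρ', hρ'0, hρ'le, hρ'1, hρ's, hρ'⟩ := exists_classLawTV_budget_lt_one hl₀ hA hB hcA hcB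
    (fun K => Real.sqrt_nonneg _) hs2 hTV
  obtain ⟨shA, shB, hNE7⟩ := exists_hybridNE7_of_target_of_classLawTV hl₀ (fun K t ht τ hτ => (hA K t ht τ hτ).le)
    (fun K t ht τ hτ => (hB K t ht τ hτ).le) hZA hZB hZA' hZB' hTgt hρ'0 hρ'1 hρ's hρ'
  exact ⟨ρ', shA, shB, fun K => ⟨hρ'0 K, hρ'le K, hρ'1 K⟩, hNE7⟩

/-- **★★ FROM ANY (H) SUPPLIER IN THE ∃-SHAPE** [folklore].  The road of `exists_hybridNE7_of_endpointLetters_noHead` with (H) given as the CONCLUSION SHAPE of the landed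
suppliers (dag-n19-w4 p618979 `affinityDefectLetter_of_tameTilts`, p620730 `affinityDefectLetter_of_kpMargins`, this seat's p622199, dag-n20-w4's `SlotDom` editions):
`∃ η ≥ 0, Σ√η < ∞, ∀ K t, |t| ≤ l₀ → 1 − 𝒜_K(t) ≤ η_K` ⇒ `∃ η Wsh shA shB` with that letter, the budget bounds, and `HybridNE7 … Wsh (K ↦ l₀·(R₁ K + 2√(2η_K)√χ)∕vol)`. -/
theorem exists_hybridNE7_of_affinityDefectLetter_and_response [DecidableEq ι] (hl₀ : 0 ≤ l₀) (hvol : 0 < vol)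
    (hA : ∀ (K : ℕ) (t : ℝ), |t| ≤ l₀ → ∀ τ ∈ T K, 0 < A K t τ) (hB : ∀ (K : ℕ) (t : ℝ), |t| ≤ l₀ → ∀ τ ∈ T K, 0 < B K t τ)
    (hZA : ∀ (K : ℕ) (t : ℝ), |t| ≤ l₀ → 0 < ∑ τ ∈ T K, A K t τ) (hZB : ∀ (K : ℕ) (t : ℝ), |t| ≤ l₀ → 0 < ∑ τ ∈ T K, B K t τ)
    {Z : ℕ → ℝ → ℝ} (hZA' : ∀ (K : ℕ) (t : ℝ), |t| ≤ l₀ → Z K t = ∑ τ ∈ T K, A K t τ)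
    (hZB' : ∀ (K : ℕ) (t : ℝ), |t| ≤ l₀ → Z (K + 1) t = ∑ τ ∈ T K, B K t τ)
    {A' B' : ℕ → ℝ → ι → ℝ}
    (hdA : ∀ (K : ℕ) (s : ℝ), |s| ≤ l₀ → ∀ τ ∈ T K, HasDerivAt (fun u => A K u τ) (A' K s τ) s)
    (hdB : ∀ (K : ℕ) (s : ℝ), |s| ≤ l₀ → ∀ τ ∈ T K, HasDerivAt (fun u => B K u τ) (B' K s τ) s)
    (hHex : ∃ η : ℕ → ℝ, (∀ K, 0 ≤ η K) ∧ Summable (fun K => Real.sqrt (η K)) ∧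
      ∀ (K : ℕ) (t : ℝ), |t| ≤ l₀ →
        1 - ∑ τ ∈ T K, Real.sqrt ((A K t τ / ∑ σ ∈ T K, A K t σ) * (B K t τ / ∑ σ ∈ T K, B K t σ)) ≤ η K)
    {R₁ : ℕ → ℝ} {χ : ℝ} {m : ℕ → ℝ → ℝ}
    (hR : ∀ (K : ℕ) (s : ℝ), |s| ≤ l₀ →
      |∑ τ ∈ T K, B K s τ / (∑ σ ∈ T K, B K s σ) * (B' K s τ / B K s τ - A' K s τ / A K s τ)| ≤ R₁ K)
    (hRs : Summable R₁)
    (hχ : ∀ (K : ℕ) (s : ℝ), |s| ≤ l₀ →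
      ∑ τ ∈ T K, (A K s τ / (∑ σ ∈ T K, A K s σ) + B K s τ / (∑ σ ∈ T K, B K s σ)) / 2 * (A' K s τ / A K s τ - m K s) ^ 2 ≤ χ) :
    ∃ (η Wsh : ℕ → ℝ) (shA shB : ℕ → ℝ → ι → ℝ),
      (∀ (K : ℕ) (t : ℝ), |t| ≤ l₀ →
        1 - ∑ τ ∈ T K, Real.sqrt ((A K t τ / ∑ σ ∈ T K, A K t σ) * (B K t τ / ∑ σ ∈ T K, B K t σ)) ≤ η K) ∧
      Summable (fun K => Real.sqrt (η K)) ∧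
      (∀ K, 0 ≤ Wsh K ∧ Wsh K ≤ Real.sqrt (2 * η K) ∧ Wsh K < 1) ∧
      HybridNE7 l₀ vol T A B (fun _ _ => ∅) (fun _ => 0) shA shB Wsh
        (fun K => l₀ * (R₁ K + 2 * Real.sqrt (2 * η K) * Real.sqrt χ) / vol) := by
  obtain ⟨η, _, hηs, hH⟩ := hHex
  obtain ⟨Wsh, shA, shB, hW, hNE7⟩ := exists_hybridNE7_of_endpointLetters_noHead hl₀ hvol hA hB hZA hZB hZA' hZB' hdA hdB
    hH hηs hR hRs hχ
  exact ⟨η, Wsh, shA, shB, hH, hηs, hW, hNE7⟩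

end Road

/-! ## §3 THE V-SIDE CAPSTONE: two refresh processes + tame tilts + (R′) + (R‑c) ⇒ stub 2's three hybrid faces at a key [by-name transfer through p622199] -/

section Capstone
variable {α : Type*} [DecidableEq ι] {l₀ vol : ℝ}

/-- **★★★ CAPSTONE — `HybridNE7` FROM TWO REFRESH PROCESSES, TAME TILTS AND THE ENDPOINT RESPONSE, NO HEAD CONDITION** [folklore + by-name transfer].  On the carrier
shapes of the key: positive class weights `A, B` DIFFERENTIABLE in the source on `|s| ≤ l₀` (`0 ≤ l₀`, `0 < vol`), the E1∕E2 dictionary, wild sets `W K t ⊆ T K`; the (V‑a)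
letters of p622199 — for EACH run an abstract refresh process with its MODELLING letter for that run's relative wild mass, common scalars `θ Λ ζ κ₁ Z₀ C₀ b`,
`κ₁(θ − Λ − ζ) > 2`; p618979's tame-tilt letters VERBATIM — radii `Σ 1∕r_K < ∞` ((V‑b) = (YG)), ONE bound `𝔅`, analytic tilts of the TAME-RESTRICTED class sums ((KR)),
tame regime from `K₀`; the R-side — (R′) `|E_{q_{K,s}}[B'∕B − A'∕A]| ≤ R₁ K`, `Σ R₁ < ∞`, (R‑c) `Σ ½(p+q)(A'∕A − m_{K,s})² ≤ χ`.  Conclusion: `∃ η Wsh shA shB` with the (H)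
letter for `η`, `Σ√η < ∞`, `0 ≤ Wsh ≤ √(2η)`, `Wsh < 1` at every key, and `HybridNE7 l₀ vol T A B (fun _ _ => ∅) (fun _ => 0) shA shB Wsh (K ↦ l₀·(R₁ K + 2√(2η_K)√χ)∕vol)`
— NE7b's weight face with NO bad class and budget `0`, NE7c's misfit shells, NE7's core edge at the endpoint-response radius. -/
theorem exists_hybridNE7_of_refreshProcesses_tameTilts_and_response (hl₀ : 0 ≤ l₀) (hvol : 0 < vol)
    (T : ℕ → Finset ι) (A B : ℕ → ℝ → ι → ℝ)
    (hA : ∀ (K : ℕ) (t : ℝ), |t| ≤ l₀ → ∀ τ ∈ T K, 0 < A K t τ) (hB : ∀ (K : ℕ) (t : ℝ), |t| ≤ l₀ → ∀ τ ∈ T K, 0 < B K t τ)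
    (hZA : ∀ (K : ℕ) (t : ℝ), |t| ≤ l₀ → 0 < ∑ τ ∈ T K, A K t τ) (hZB : ∀ (K : ℕ) (t : ℝ), |t| ≤ l₀ → 0 < ∑ τ ∈ T K, B K t τ)
    {Z : ℕ → ℝ → ℝ} (hZA' : ∀ (K : ℕ) (t : ℝ), |t| ≤ l₀ → Z K t = ∑ τ ∈ T K, A K t τ)
    (hZB' : ∀ (K : ℕ) (t : ℝ), |t| ≤ l₀ → Z (K + 1) t = ∑ τ ∈ T K, B K t τ)
    {A' B' : ℕ → ℝ → ι → ℝ}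
    (hdA : ∀ (K : ℕ) (s : ℝ), |s| ≤ l₀ → ∀ τ ∈ T K, HasDerivAt (fun u => A K u τ) (A' K s τ) s)
    (hdB : ∀ (K : ℕ) (s : ℝ), |s| ≤ l₀ → ∀ τ ∈ T K, HasDerivAt (fun u => B K u τ) (B' K s τ) s)
    -- (V‑a): the two refresh processes (p622199's letters, verbatim)
    (W : ℕ → ℝ → Finset ι) (hW : ∀ K t, W K t ⊆ T K)
    {θ Λ ζ κ₁ Z₀ C₀ : ℝ} (b : ℝ) (hθ : 0 ≤ θ) (hΛθ : Λ + ζ < θ) (hκ : 2 < κ₁ * (θ - Λ - ζ)) (hC₀ : 0 ≤ C₀)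
    (UA UB : ℕ → ℝ → ℕ → Finset α) (wA ℓA PA wB ℓB PB : ℕ → ℝ → ℕ → α → ℝ)
    (hwA0 : ∀ K t m, ∀ j ∈ UA K t m, 0 ≤ wA K t m j) (hwB0 : ∀ K t m, ∀ j ∈ UB K t m, 0 ≤ wB K t m j)
    (hwA : ∀ K t m, ∀ j ∈ UA K t m, wA K t m j ≤ Real.exp (-PA K t m j))
    (hwB : ∀ K t m, ∀ j ∈ UB K t m, wB K t m j ≤ Real.exp (-PB K t m j))
    (hθPA : ∀ K t m, ∀ j ∈ UA K t m, θ * ℓA K t m j ≤ PA K t m j / 2)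
    (hθPB : ∀ K t m, ∀ j ∈ UB K t m, θ * ℓB K t m j ≤ PB K t m j / 2)
    (hZ0A : ∀ K t (m : ℕ), ∑ j ∈ UA K t m, Real.exp (-(PA K t m j / 2)) ≤ Z₀ + ζ * m)
    (hZ0B : ∀ K t (m : ℕ), ∑ j ∈ UB K t m, Real.exp (-(PB K t m j / 2)) ≤ Z₀ + ζ * m)
    (hmodelA : ∀ (K : ℕ) (t : ℝ), |t| ≤ l₀ → 1 ≤ K → ∀ s : ℝ,
      (∀ M : ℕ, ∑ m ∈ range M, (if b + κ₁ * Real.log (K : ℝ) ≤ (m : ℝ) then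
          Real.exp (Λ * m) * ∑ S ∈ (UA K t m).powerset with ((m : ℝ) - b ≤ ∑ j ∈ S, ℓA K t m j), ∏ j ∈ S, wA K t m j
        else 0) ≤ s) →
      (∑ τ ∈ W K t, A K t τ) / (∑ σ ∈ T K, A K t σ) ≤ C₀ * s)
    (hmodelB : ∀ (K : ℕ) (t : ℝ), |t| ≤ l₀ → 1 ≤ K → ∀ s : ℝ,
      (∀ M : ℕ, ∑ m ∈ range M, (if b + κ₁ * Real.log (K : ℝ) ≤ (m : ℝ) then
          Real.exp (Λ * m) * ∑ S ∈ (UB K t m).powerset with ((m : ℝ) - b ≤ ∑ j ∈ S, ℓB K t m j), ∏ j ∈ S, wB K t m j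
        else 0) ≤ s) →
      (∑ τ ∈ W K t, B K t τ) / (∑ σ ∈ T K, B K t σ) ≤ C₀ * s)
    -- (V‑b) ∕ (KR) ∕ regime: p618979's tame-tilt letters, verbatim
    (r : ℕ → ℝ) (hr : ∀ K, 0 < r K) (hrs : Summable fun K => 1 / r K)
    {𝔅 : ℝ} (h𝔅 : 0 ≤ 𝔅)
    (htilt : ∀ K t, |t| ≤ l₀ → ∃ φA φB : ℂ → ℂ,
      DifferentiableOn ℂ φA (Metric.closedBall 0 (r K)) ∧ DifferentiableOn ℂ φB (Metric.closedBall 0 (r K)) ∧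
      (∀ s ∈ Metric.closedBall (0:ℂ) (r K), Complex.exp (φA s)
        = (∑ τ ∈ T K \ W K t, (A K t τ : ℂ) * Complex.exp (s * ((Real.log (B K t τ) - Real.log (A K t τ) : ℝ) : ℂ)))
            / ∑ τ ∈ T K \ W K t, (A K t τ : ℂ)) ∧
      (∀ s ∈ Metric.closedBall (0:ℂ) (r K), Complex.exp (φB s)
        = (∑ τ ∈ T K \ W K t, (B K t τ : ℂ) * Complex.exp (s * ((Real.log (B K t τ) - Real.log (A K t τ) : ℝ) : ℂ)))
            / ∑ τ ∈ T K \ W K t, (B K t τ : ℂ)) ∧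
      (∀ s ∈ Metric.closedBall (0:ℂ) (r K), ‖φA s‖ ≤ 𝔅) ∧ (∀ s ∈ Metric.closedBall (0:ℂ) (r K), ‖φB s‖ ≤ 𝔅))
    (K₀ : ℕ) (hreg : ∀ K, K₀ ≤ K → ∀ t, |t| ≤ l₀ →
      1 - ∑ τ ∈ T K \ W K t, Real.sqrt ((A K t τ / ∑ σ ∈ T K \ W K t, A K t σ) * (B K t τ / ∑ σ ∈ T K \ W K t, B K t σ))
        ≤ 1 / 16)
    -- the R-side: (R′) + (R‑c)
    {R₁ : ℕ → ℝ} {χ : ℝ} {m : ℕ → ℝ → ℝ}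
    (hR : ∀ (K : ℕ) (s : ℝ), |s| ≤ l₀ →
      |∑ τ ∈ T K, B K s τ / (∑ σ ∈ T K, B K s σ) * (B' K s τ / B K s τ - A' K s τ / A K s τ)| ≤ R₁ K)
    (hRs : Summable R₁)
    (hχ : ∀ (K : ℕ) (s : ℝ), |s| ≤ l₀ →
      ∑ τ ∈ T K, (A K s τ / (∑ σ ∈ T K, A K s σ) + B K s τ / (∑ σ ∈ T K, B K s σ)) / 2 * (A' K s τ / A K s τ - m K s) ^ 2 ≤ χ) :
    ∃ (η Wsh : ℕ → ℝ) (shA shB : ℕ → ℝ → ι → ℝ),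
      (∀ (K : ℕ) (t : ℝ), |t| ≤ l₀ →
        1 - ∑ τ ∈ T K, Real.sqrt ((A K t τ / ∑ σ ∈ T K, A K t σ) * (B K t τ / ∑ σ ∈ T K, B K t σ)) ≤ η K) ∧
      Summable (fun K => Real.sqrt (η K)) ∧
      (∀ K, 0 ≤ Wsh K ∧ Wsh K ≤ Real.sqrt (2 * η K) ∧ Wsh K < 1) ∧
      HybridNE7 l₀ vol T A B (fun _ _ => ∅) (fun _ => 0) shA shB Wsh
        (fun K => l₀ * (R₁ K + 2 * Real.sqrt (2 * η K) * Real.sqrt χ) / vol) :=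
  exists_hybridNE7_of_affinityDefectLetter_and_response hl₀ hvol hA hB hZA hZB hZA' hZB' hdA hdB
    (affinityDefectLetter_of_refreshProcesses_and_tameTilts T A B hA hB W hW b hθ hΛθ hκ hC₀ UA UB wA ℓA PA wB ℓB PB
      hwA0 hwB0 hwA hwB hθPA hθPB hZ0A hZ0B hmodelA hmodelB r hr hrs h𝔅 htilt K₀ hreg)
    hR hRs hχ

end Capstone

/-! ## §4 Toy (A6) -/

/-- [toy] Identical positive runs have class-law gap `0` on every set — in particular `< 1`, the letter of §1 non-vacuously. -/
theorem toy_identical_runs_gap {T S : Finset ι} {A : ι → ℝ} (hA : ∀ τ ∈ T, 0 < A τ) (hS : S ⊆ T) :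
    |(∑ τ ∈ S, A τ) / (∑ τ ∈ T, A τ) - (∑ τ ∈ S, A τ) / (∑ τ ∈ T, A τ)| = 0 ∧
      |(∑ τ ∈ S, A τ) / (∑ τ ∈ T, A τ) - (∑ τ ∈ S, A τ) / (∑ τ ∈ T, A τ)| < 1 :=
  ⟨by simp, abs_classLawGap_lt_one hA hA hS⟩

end Summit.QuantumFields.YangMills.BalabanUVNodes.N20HellingerRoadCapstone

end
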